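import Summits.ABC.StewartYu.ArchG3RecLinesHCoreB
import Summits.ABC.StewartYu.ArchG3RecLinesHCoreC
import Summits.ABC.StewartYu.ArchG3RecLinesFK
import HarnessLib

/-!
# The archimedean record `ArchG3Rec` — letter lines in closed form, H family (half step): THE (F) LINE

Support file (theorems only; no named facts). Cell `abc-stewartyu`, route `YuMatveevShapeRat`, crux r2 `ArchCoreRat` (stmt-ABC-20502),
line `arch-g3-frame`, seam (B) of `stub_recLinesArch`, plan R50: **the growth line (F) of the half step `(lev, n) → (lev+1, 0)`** of
`HalfStepLinesK (2^(n−1)) c lev` (`halfF_holds`, for `n ≥ 2`, `lev < Ŝ`, `c ≥ 2^63`).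
LEDGER (atoms `nB = n·2ⁿ·X·L`, `B = 2ⁿ·X·L`; regimes `lev = 0`: `σ = 35/4`, `g = 8 − 2⁻²⁰` / `lev ≥ 1`: `σ = 19/4`, `g = 4`, where
`Tf (lev+1) 0 ≤ σ(n+1)L` and gain `≥ g·2ⁿ·Z = 8g·(nB + B)`): every `T′`-cost via `Tcost_le`, the start print via p1's
`cPRK_two_pow_le` (`≤ 51/25·Z`), the Δ-weight via p1's `logDΔCK_le`, the Hasse weights via `logWC_half_le`, the jets radius via
`sAbs_sum_le`, the slab via `gamma_le`/`wl_rhoF_le`, the weights via `nsq_Omega_le`, the smallness product via `small_prod_le`;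
total `≤ (0.9σ + 26)·nB + (1.3σ + 23.1)·B ≤ 8g·(nB + B)` (`30.3, 29.3 ≤ 32` resp. `33.9, 34.5 ≤ 64`).

## References
* [Nesterenko2003] Yu. V. Nesterenko, LNM 1819 (2003) — §4 Prop. 4.1, §4.3 (4.36)–(4.51); shape only.
-/

noncomputable section

open Finset Real
open scoped Nat
open Summit.ABC.StewartYu.ArchSupply (WC)
open Summit.ABC.StewartYu.ArchG3Setup (DΔC)

namespace Summit.ABC.StewartYu

namespace ArchG3Rec

open PadicG3Par (Cb Cb_pos)
open ArchG3Par (G K yloadK G_eq G_pos K_pos yloadK_pos eight_le_G one_le_K)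

variable {n : ℕ} (P : ArchG3Rec n)

/-- the two regimes of the half step packaged: `∃ σ g`, `Tf (lev+1) 0 ≤ σ(n+1)L`, `g·2ⁿZ ≤ gain`, and the two numeric budget
inequalities of the (F) ledger. [cite: Nesterenko2003, (4.3)–(4.5); shape only] -/
theorem half_regime (hn2 : 2 ≤ n) {lev : ℕ} (hlev : lev < P.Sd) :
    ∃ σ g : ℝ, 0 ≤ σ ∧ (P.Tf (lev + 1) 0 : ℝ) ≤ σ * (((n : ℝ) + 1) * P.L) ∧
      g * (2 ^ n * P.Z) ≤ (((2 * P.Nf lev n + 1) * P.T lev : ℕ) : ℝ) * G n ∧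
      9 / 10 * σ + 26 ≤ 8 * g ∧ 13 / 10 * σ + 231 / 10 ≤ 8 * g := by
  rcases Nat.eq_zero_or_pos lev with rfl | hlev1
  · have hT : (P.T 0 : ℝ) ≤ 8 * P.L := by rw [P.T_zero_real]
    obtain ⟨hT', -⟩ := P.Tsucc_le hn2 hlev hT
    exact ⟨8 + 3 / 4, 8 - 1 / 2 ^ 20, by norm_num, hT', P.gain_zero hn2, by norm_num, by norm_num⟩
  · have hT : (P.T lev : ℝ) ≤ 4 * P.L := P.T_le_four_L hlev1
    obtain ⟨hT', -⟩ := P.Tsucc_le hn2 hlev hT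
    refine ⟨4 + 3 / 4, 4, by norm_num, hT', ?_, by norm_num, by norm_num⟩
    have := P.gain_four lev; linarith

/-- **the (F) line of the half step** `(lev, n) → (lev+1, 0)` of `HalfStepLinesK (2^(n−1)) c lev` (growth of the auxiliary function
on the radius `(3e^G+1)(2Nf+1) + Nf` against the zeros gain `(2Nf+1)·T·G`), for `n ≥ 2`, `lev < Ŝ`, `c ≥ 2^63`.
[cite: Nesterenko2003, §4.3 (4.36)–(4.47); shape only] -/
theorem halfF_holds (hn2 : 2 ≤ n) {lev : ℕ} (hlev : lev < P.Sd) {c : ℝ} (hc : (2 : ℝ) ^ 63 ≤ c)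
    (s : ℤ) (a : ℕ) (hsabs : |s| ≤ 2 * (P.Nh (lev + 1) : ℤ) - 1) (ha : a < P.Tf (lev + 1) 0) :
    P.γb lev * (3 * P.Nf lev n + 2) + P.cUR + P.cPRK (2 ^ (n - 1)) + Real.log (DΔC (P.YRK (2 ^ (n - 1)) lev) (P.Tf (lev + 1) 0)) +
      Real.log (WC P.H (P.Sd - (lev + 1) + 1) P.L₀ (P.Tf (lev + 1) 0) ((3 * Real.exp (G n) + 1) * (2 * P.Nf lev n + 1) + P.Nf lev n)) +
      (P.wl lev + (P.LbRK (2 ^ (n - 1)) lev P.jl : ℝ) * P.δR c) * ((3 * Real.exp (G n) + 1) * (2 * P.Nf lev n + 1) + P.Nf lev n) -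
      (((2 * P.Nf lev n + 1) * P.T lev : ℕ) : ℝ) * G n +
      (2 : ℝ) ^ n * (Real.log 4 + (23 / 20 * a * P.H + (|(s : ℝ)| * ∑ j, ((P.LνRR lev j : ℝ) / P.N) * P.A j + n * P.SAR + 2 * P.SAR)) +
        (Real.log 2 + P.cUR + P.cPRK (2 ^ (n - 1)) + Real.log (DΔC (P.YRK (2 ^ (n - 1)) lev) (P.Tf (lev + 1) 0)) +
          (Real.log (WC P.H (P.Sd - (lev + 1) + 1) P.L₀ (P.Tf (lev + 1) 0) (P.Nh (lev + 1))) + (P.γb lev + P.wl lev) * P.Nh (lev + 1) +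
            P.AθsumR / 2)) + 2 * P.cHR) +
      Real.log 3 ≤ 0 := by
  have hκ : 1 ≤ 2 ^ (n - 1) := Nat.one_le_two_pow
  obtain ⟨-, -, hG, hL0, -, -, -⟩ := P.letters_real lev
  have hX : (128 : ℝ) ≤ P.X := P.X_floors.2.1
  have hn : (2 : ℝ) ≤ n := by exact_mod_cast hn2
  have hn0 : (0 : ℝ) ≤ n := by linarith
  have h2n : (4 : ℝ) ≤ 2 ^ n :=
    calc (4 : ℝ) = 2 ^ 2 := by norm_num
      _ ≤ 2 ^ n := pow_le_pow_right₀ (by norm_num) hn2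
  have h2n0 : (0 : ℝ) ≤ 2 ^ n := by positivity
  set XL : ℝ := (P.X : ℝ) * P.L with hXL
  have hXL0 : 0 < XL := by positivity
  have hZ : P.Z = 8 * ((n : ℝ) + 1) * XL := by unfold Z; rw [hG]
  -- the regime
  obtain ⟨σ, g, hσ0, hT', hE, hbud1, hbud2⟩ := P.half_regime hn2 hlev
  have hT'0 : (0 : ℝ) ≤ P.Tf (lev + 1) 0 := Nat.cast_nonneg _
  obtain ⟨-, tn, t1, tW, tN, tS, tH⟩ := P.Tcost_le hT'0 hσ0 hT'
  -- the comparison constant `U0 ≥ XL/2^16`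
  have hU : XL / 2 ^ 16 ≤ P.U0 c := by
    have hU0 := P.U0_ge 3 hc
    have h1 : (1 : ℝ) ≤ 2 ^ (3 * n) := one_le_pow₀ (by norm_num)
    have h2 : XL ≤ P.Z := by rw [hZ]; nlinarith
    have h3 : P.Z ≤ 2 ^ (3 * n) * P.Z := le_mul_of_one_le_left (by linarith) h1
    have h4 : XL / 2 ^ 16 ≤ XL := div_le_self hXL0.le (by norm_num)
    linarith
  -- the radii
  obtain ⟨hρNh, hρF, -, hρF0, hNf0, hNh0⟩ := P.rho_bounds lev
  obtain ⟨-, hρF1, -⟩ := P.rho_succ_bounds lev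
  -- (1) the slab
  obtain ⟨hγ1, hγ2, -, hγ0, hwl0⟩ := P.gamma_le lev
  -- (2) the unit count and the start print
  obtain ⟨hcU, -⟩ := P.cUR_le' hn2
  have hcP := P.cPRK_two_pow_le hn2
  -- (3) the Δ-weight
  have hD := P.logDΔCK_le (2 ^ (n - 1)) hκ lev (lev + 1) 0
  obtain ⟨hlogκ, -⟩ := log_kappa_le P.hn
  have hlog3n : Real.log ((n : ℝ) + 2) ≤ (n : ℝ) + 1 := by
    have := Real.log_le_sub_one_of_pos (by positivity : (0 : ℝ) < n + 2); linarith only [this]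
  have hD' : Real.log (DΔC (P.YRK (2 ^ (n - 1)) lev) (P.Tf (lev + 1) 0)) ≤
      σ * P.Z / 64 + σ * P.Z / 64 + 17 / 10 * (σ * (((n : ℝ) + 1) * XL) / 64) + 3 * (σ * (((n : ℝ) + 1) * XL) / 64) + σ * XL / 64 := by
    have k1 : (P.Tf (lev + 1) 0 : ℝ) * Real.log (((2 ^ (n - 1) : ℕ) : ℝ) * n) ≤ (P.Tf (lev + 1) 0 : ℝ) * (17 / 10 * n) :=
      mul_le_mul_of_nonneg_left hlogκ hT'0
    have k2 : (P.Tf (lev + 1) 0 : ℝ) * (17 / 10 * (n : ℝ)) ≤ 17 / 10 * ((P.Tf (lev + 1) 0 : ℝ) * ((n : ℝ) + 1)) := by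
      have e2 : 17 / 10 * ((P.Tf (lev + 1) 0 : ℝ) * ((n : ℝ) + 1)) = (P.Tf (lev + 1) 0 : ℝ) * (17 / 10 * (n : ℝ)) + 17 / 10 * (P.Tf (lev + 1) 0 : ℝ) := by ring
      rw [e2]; linarith only [hT'0]
    have k3 : (P.Tf (lev + 1) 0 : ℝ) * Real.log ((n : ℝ) + 2) ≤ (P.Tf (lev + 1) 0 : ℝ) * ((n : ℝ) + 1) := mul_le_mul_of_nonneg_left hlog3n hT'0
    have e : (P.Tf (lev + 1) 0 : ℝ) * (P.WN + Real.log P.N + Real.log (((2 ^ (n - 1) : ℕ) : ℝ) * n) + 3 * Real.log ((n : ℝ) + 2) + 1) =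
        (P.Tf (lev + 1) 0 : ℝ) * P.WN + (P.Tf (lev + 1) 0 : ℝ) * Real.log P.N + (P.Tf (lev + 1) 0 : ℝ) * Real.log (((2 ^ (n - 1) : ℕ) : ℝ) * n) +
          3 * ((P.Tf (lev + 1) 0 : ℝ) * Real.log ((n : ℝ) + 2)) + (P.Tf (lev + 1) 0 : ℝ) := by ring
    linarith only [hD, e, k1, k2, k3, tW, tN, tn, t1]
  -- (4) the Hasse weights
  have hWF := P.logWC_half_le hn2 hlev (P.Tf (lev + 1) 0) hρF0 hρF
  have hWh := P.logWC_half_le hn2 hlev (P.Tf (lev + 1) 0) hNh0 hρNh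
  have hdeb := P.debris_le hn2
  -- (5) the slab width and the smallness product on the growth radius
  have hwlρ := P.wl_rhoF_le lev
  have hsm := P.small_prod_le hn2 hlev.le hU hρF0 hρF1
  -- (7) the jets bracket
  obtain ⟨hsS, hS00, -⟩ := P.sAbs_sum_le lev hsabs
  obtain ⟨-, hnS, hS, hAθ, hcH, hS0, hAθ0⟩ := P.nsq_Omega_le
  obtain ⟨hl2, hl3, hl4, -⟩ := log_consts
  have ha' : (a : ℝ) ≤ P.Tf (lev + 1) 0 := by exact_mod_cast ha.le
  obtain ⟨hH1, -, -⟩ := P.H_bounds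
  have haH : 23 / 20 * (a : ℝ) * P.H ≤ 23 / 20 * (σ * (((n : ℝ) + 1) * XL) / 8) := by
    have := mul_le_mul_of_nonneg_right ha' (Nat.cast_nonneg P.H)
    linarith only [this, tH]
  -- the jets bracket without its slab term
  have hJ : Real.log 4 + (23 / 20 * a * P.H + (|(s : ℝ)| * ∑ j, ((P.LνRR lev j : ℝ) / P.N) * P.A j + n * P.SAR + 2 * P.SAR)) +
        (Real.log 2 + P.cUR + P.cPRK (2 ^ (n - 1)) + Real.log (DΔC (P.YRK (2 ^ (n - 1)) lev) (P.Tf (lev + 1) 0)) +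
          (Real.log (WC P.H (P.Sd - (lev + 1) + 1) P.L₀ (P.Tf (lev + 1) 0) (P.Nh (lev + 1))) + (P.γb lev + P.wl lev) * P.Nh (lev + 1) +
            P.AθsumR / 2)) + 2 * P.cHR ≤
      (23 / 20 * (σ * (((n : ℝ) + 1) * XL) / 8) + (2 + 1 / 2 ^ 6) * n * XL + 11 / 2 * (P.Z / 3072) + (P.Z / 392 + P.Z / 2 ^ 29) + 51 / 25 * P.Z +
        (σ * P.Z / 64 + σ * P.Z / 64 + 17 / 10 * (σ * (((n : ℝ) + 1) * XL) / 64) + 3 * (σ * (((n : ℝ) + 1) * XL) / 64) + σ * XL / 64) +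
        (σ * (10 * (((n : ℝ) + 1) * XL) + 19 * XL) / 64 + σ * P.Z / 64 + 22 / 100 * P.Z) + XL / 2 ^ 26) +
        (P.γb lev + P.wl lev) * P.Nh (lev + 1) := by
    linarith only [haH, hsS, hnS, hS, hAθ, hcH, hcU, hcP, hD', hWh, tS, hdeb, hl2, hl4]
  have hJ2 := mul_le_mul_of_nonneg_left hJ h2n0
  -- the transfers between the currencies
  have hC4 : 4 * (((n : ℝ) + 1) * XL) ≤ 2 ^ n * (((n : ℝ) + 1) * XL) := mul_le_mul_of_nonneg_right h2n (by positivity)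
  have hD4 : 4 * XL ≤ 2 ^ n * XL := mul_le_mul_of_nonneg_right h2n hXL0.le
  have hσC4 : 4 * (σ * (((n : ℝ) + 1) * XL)) ≤ 2 ^ n * (σ * (((n : ℝ) + 1) * XL)) := mul_le_mul_of_nonneg_right h2n (by positivity)
  have hσD4 : 4 * (σ * XL) ≤ 2 ^ n * (σ * XL) := mul_le_mul_of_nonneg_right h2n (by positivity)
  have hnB0 : 0 ≤ (n : ℝ) * (2 ^ n * XL) := by positivity
  have hB0 : 0 ≤ 2 ^ n * XL := by positivity
  have hσnB : 0 ≤ σ * ((n : ℝ) * (2 ^ n * XL)) := mul_nonneg hσ0 hnB0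
  have hσB : 0 ≤ σ * (2 ^ n * XL) := mul_nonneg hσ0 hB0
  have hb1 := mul_le_mul_of_nonneg_right hbud1 hnB0
  have hb2 := mul_le_mul_of_nonneg_right hbud2 hB0
  rw [hZ] at hE hJ2 hcU hcP hD' hWF hWh hS hnS hAθ hcH tS
  linarith only [hJ2, hE, hb1, hb2, hγ1, hγ2, hcU, hcP, hD', hWF, tS, hdeb, hwlρ, hsm, hl3, hC4, hD4, hσC4, hσD4, hσnB, hσB,
    hnB0, hB0, hXL0, hσ0]

end ArchG3Rec

end Summit.ABC.StewartYu

end
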